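import Mathlib
import Literature.Geometry.Riemannian.SphericalZonalGaussianBounds
import Literature.Geometry.Riemannian.SphericalZonalSixPositivity
import Literature.Geometry.Riemannian.SphericalZonalFourDuality
import Literature.Analysis.SpecialFunctions.GegenbauerOrthogonality
import HarnessLib

/-!
# Certificate infrastructure 2/4: exact rational Gegenbauer recurrence and zonal partial sums

Helper for the line `conformal-kernel-domination` of the crux
`Summit.SmoothPoincare4.SmoothPoincare4.Theses.CylinderEntropy.SliceIsolation` (crux item
stmt-SmoothPoincare4-7632).  The computable interval checker run by `native_decide` needs a LOWER bound
of the typed zonal heat kernel of `S⁴`,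
`zonal τ s = ∑' k, wt k τ * gegen k s` (`wt k τ = e^{-k(k+3)τ} (2k+3)/3`, `gegen k = C_k^{(3/2)}`),
at the scales `τ = -(log q)/2`, `q ∈ ℚ ∩ (0, 1)`, where the weights are the EXACT rational powers
`q^{k(k+3)/2}`.  Everything the checker evaluates is a plain computable `def` over `ℚ`/`ℕ`
(namespace `Cert`); the soundness theorems relate them to `ℝ` through the cast `((x : ℚ) : ℝ)`.

* `Cert.gegenPair n s = (C_n(s), C_{n+1}(s))` by the three-term recurrence
  `(n+2) C_{n+2} = (2n+5) s C_{n+1} - (n+3) C_n`, `C_0 = 1`, `C_1 = 3s`; `Cert.gegenQ k s = C_k(s)`,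
  cast-equal to the tree's `gegen k s` (`Cert.gegenQ_cast`, from `gegenbauerSum_rec` with `a = 3/2`).
* `Cert.zonalPartialQ q s K = Σ_{k ≤ K} q^{k(k+3)/2} (2k+3)/3 · C_k(s)` computed in ONE pass
  (`Cert.zonalState` carries `C_k, C_{k+1}, q^{k(k+3)/2}` and the accumulator), cast-equal to the
  `Finset` sum of `partialSum_sub_geometric_le_zonal` (`Cert.zonalPartialQ_cast`).
* `Cert.zonalTailQ q K = ρ^{K+1}/(1-ρ)`, `ρ = 32 q^{⌊(K+4)/2⌋}`, the crude geometric tail, and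
  `Cert.zonalLoSeries = zonalPartialQ - zonalTailQ ≤ zonal (-(log q)/2) s` for `|s| ≤ 1`, `ρ < 1`
  (`Cert.zonalLoSeries_le_zonal`); with the monotonicity of `zonal τ` on `[-1, 1]` this gives the
  registered helper `helper_certZonalLoSeries` (a lower bound on `[s, 1]` from the value at `s`).
* `Cert.zonalLoSeriesR q s K p ≤ Cert.zonalLoSeries q s K`: the same bound with the weights and the
  accumulator rounded (outwards) to `p` fractional bits — about an order of magnitude faster under
  `native_decide` — with the same soundness statements (`Cert.zonalLoSeriesR_le_zonal`,
  `Cert.zonalLoSeriesR_le_zonal_of_le`).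
* `Cert.zonalPoleLo q K = Σ_{k ≤ K} q^{k(k+3)/2} (2k+3)/3 · (k+1)(k+2)/2 ≤ zonal (-(log q)/2) 1`
  (`Cert.zonalPoleLo_le`, nonnegative terms of the series at the pole, `C_k(1) = (k+1)(k+2)/2`).
-/

-- the registered namespace `Summit.SmoothPoincare4.SmoothPoincare4.Theorems…` repeats a component
set_option linter.dupNamespace false

namespace Summit.SmoothPoincare4.SmoothPoincare4.Theorems.CylinderEntropySliceIsolation

open Literature.Geometry.Riemannian.SphericalCylinderEntropy
open Literature.Geometry.Riemannian.SphericalZonalKernelSeries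
open Literature.Analysis.SpecialFunctions

namespace Cert

/-! ### The Gegenbauer polynomials `C_k^{(3/2)}` over `ℚ` by the three-term recurrence -/

/-- The pair `(C_n^{(3/2)}(s), C_{n+1}^{(3/2)}(s))` over `ℚ`, by the three-term recurrence
`(n+2) C_{n+2} = (2n+5) s C_{n+1} - (n+3) C_n` from `(C_0, C_1) = (1, 3s)` (one recursive call per
step, so linear time). [folklore] -/
def gegenPair : ℕ → ℚ → ℚ × ℚ
  | 0, s => (1, 3 * s)
  | n + 1, s =>
    let p := gegenPair n s
    (p.2, ((2 * (n : ℚ) + 5) * s * p.2 - ((n : ℚ) + 3) * p.1) / ((n : ℚ) + 2))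

/-- The Gegenbauer polynomial `C_k^{(3/2)}(s)` evaluated exactly over `ℚ`. [folklore] -/
def gegenQ (k : ℕ) (s : ℚ) : ℚ := (gegenPair k s).1

/-- `C_0 = 1`. [folklore] -/
@[simp] theorem gegenQ_zero (s : ℚ) : gegenQ 0 s = 1 := rfl

/-- `C_1(s) = 3s`. [folklore] -/
@[simp] theorem gegenQ_one (s : ℚ) : gegenQ 1 s = 3 * s := rfl

/-- The second component of `gegenPair n s` is `C_{n+1}(s)`. [folklore] -/
theorem gegenPair_snd (n : ℕ) (s : ℚ) : (gegenPair n s).2 = gegenQ (n + 1) s := rfl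

/-- The recurrence `C_{k+2} = ((2k+5) s C_{k+1} - (k+3) C_k)/(k+2)` satisfied by `gegenQ`.
[folklore] -/
theorem gegenQ_succ_succ (k : ℕ) (s : ℚ) :
    gegenQ (k + 2) s =
      ((2 * (k : ℚ) + 5) * s * gegenQ (k + 1) s - ((k : ℚ) + 3) * gegenQ k s) / ((k : ℚ) + 2) := rfl

/-- The tree's recurrence for `gegen = C^{(3/2)}`, solved for `C_{k+2}`:
`gegen (k+2) s = ((2k+5) s · gegen (k+1) s - (k+3) · gegen k s)/(k+2)`. [folklore] -/
theorem gegen_succ_succ (k : ℕ) (s : ℝ) :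
    gegen (k + 2) s =
      ((2 * (k : ℝ) + 5) * s * gegen (k + 1) s - ((k : ℝ) + 3) * gegen k s) / ((k : ℝ) + 2) := by
  have hrec := gegenbauerSum_rec (((1 : ℕ) : ℝ) + 1 / 2) k s
  rw [← gegen_eq_gegenbauerSum, ← gegen_eq_gegenbauerSum, ← gegen_eq_gegenbauerSum] at hrec
  have hk : ((k : ℝ) + 2) ≠ 0 := by positivity
  rw [eq_div_iff hk]
  push_cast at hrec
  linear_combination hrec

/-- **Soundness of the recurrence**: `gegenQ k s` casts to the tree's `gegen k s`. [folklore] -/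
theorem gegenQ_cast (k : ℕ) (s : ℚ) : ((gegenQ k s : ℚ) : ℝ) = gegen k (s : ℝ) := by
  induction k using Nat.twoStepInduction with
  | zero => simp
  | one =>
    rw [gegenQ_one, gegen_eq_gegenbauerSum, gegenbauerSum_one]
    push_cast
    ring
  | more k ih0 ih1 =>
    rw [gegenQ_succ_succ, gegen_succ_succ]
    push_cast
    rw [ih0, ih1]

/-! ### One-pass partial sums of the zonal series at `τ = -(log q)/2` -/

/-- The state of the one-pass summation after `k` steps:
`(C_k(s), C_{k+1}(s), q^{k(k+3)/2}, Σ_{j<k} q^{j(j+3)/2} (2j+3)/3 · C_j(s))`; the power is updated by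
`q^{(k+1)(k+4)/2} = q^{k(k+3)/2} · q^{k+2}`. [folklore] -/
def zonalState (q s : ℚ) : ℕ → ℚ × ℚ × ℚ × ℚ
  | 0 => (1, 3 * s, 1, 0)
  | k + 1 =>
    let p := zonalState q s k
    (p.2.1, ((2 * (k : ℚ) + 5) * s * p.2.1 - ((k : ℚ) + 3) * p.1) / ((k : ℚ) + 2),
      p.2.2.1 * q ^ (k + 2), p.2.2.2 + p.2.2.1 * ((2 * (k : ℚ) + 3) / 3) * p.1)

/-- The partial sum `Σ_{k ≤ K} q^{k(k+3)/2} (2k+3)/3 · C_k^{(3/2)}(s)` of the zonal series at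
`τ = -(log q)/2`, computed exactly over `ℚ` in one pass. [folklore] -/
def zonalPartialQ (q s : ℚ) (K : ℕ) : ℚ := (zonalState q s (K + 1)).2.2.2

/-- The exponent update `k(k+3)/2 + (k+2) = (k+1)(k+4)/2` (exact: `k(k+3)` is even). [folklore] -/
theorem half_mul_add_three_succ (k : ℕ) :
    k * (k + 3) / 2 + (k + 2) = (k + 1) * (k + 1 + 3) / 2 := by
  have h : (k + 1) * (k + 1 + 3) = k * (k + 3) + 2 * (k + 2) := by ring
  rw [h, Nat.add_mul_div_left _ _ (by norm_num : 0 < 2)]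

/-- The invariant of the one-pass summation. [folklore] -/
theorem zonalState_eq (q s : ℚ) (k : ℕ) :
    zonalState q s k =
      (gegenQ k s, gegenQ (k + 1) s, q ^ (k * (k + 3) / 2),
        ∑ j ∈ Finset.range k, q ^ (j * (j + 3) / 2) * ((2 * (j : ℚ) + 3) / 3) * gegenQ j s) := by
  induction k with
  | zero => simp [zonalState]
  | succ k ih =>
    rw [zonalState, ih]
    dsimp only
    rw [Finset.sum_range_succ, ← gegenQ_succ_succ, ← pow_add, half_mul_add_three_succ]

/-- **Soundness of the partial sums**: `zonalPartialQ q s K` casts to the `Finset` partial sum of the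
zonal series at `τ = -(log q)/2` appearing in `partialSum_sub_geometric_le_zonal`. [folklore] -/
theorem zonalPartialQ_cast (q s : ℚ) (K : ℕ) :
    ((zonalPartialQ q s K : ℚ) : ℝ) =
      ∑ k ∈ Finset.range (K + 1),
        (q : ℝ) ^ (k * (k + 3) / 2) * ((2 * (k : ℝ) + 3) / 3) * gegen k (s : ℝ) := by
  rw [zonalPartialQ, zonalState_eq]
  push_cast
  refine Finset.sum_congr rfl fun k _ => ?_
  rw [gegenQ_cast]

/-- The crude geometric tail `ρ^{K+1}/(1-ρ)`, `ρ = 32 q^{⌊(K+4)/2⌋}`, of the zonal series beyond `K`.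
[folklore] -/
def zonalTailQ (q : ℚ) (K : ℕ) : ℚ :=
  (32 * q ^ ((K + 4) / 2)) ^ (K + 1) / (1 - 32 * q ^ ((K + 4) / 2))

/-- The cast of the geometric tail. [folklore] -/
theorem zonalTailQ_cast (q : ℚ) (K : ℕ) :
    ((zonalTailQ q K : ℚ) : ℝ) =
      (32 * (q : ℝ) ^ ((K + 4) / 2)) ^ (K + 1) / (1 - 32 * (q : ℝ) ^ ((K + 4) / 2)) := by
  rw [zonalTailQ]
  push_cast
  rfl

/-- The certified series lower bound `Σ_{k ≤ K} q^{k(k+3)/2} (2k+3)/3 · C_k(s) - ρ^{K+1}/(1-ρ)` of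
`zonal (-(log q)/2) s`. [folklore] -/
def zonalLoSeries (q s : ℚ) (K : ℕ) : ℚ := zonalPartialQ q s K - zonalTailQ q K

/-- **Soundness of the series lower bound**: for `0 < q < 1`, `|s| ≤ 1` and `32 q^{⌊(K+4)/2⌋} < 1`,
`zonalLoSeries q s K ≤ zonal (-(log q)/2) s`. [folklore] -/
theorem zonalLoSeries_le_zonal {q s : ℚ} (K : ℕ) (hq0 : 0 < q) (hq1 : q < 1)
    (hρ : 32 * q ^ ((K + 4) / 2) < 1) (hs1 : -1 ≤ s) (hs2 : s ≤ 1) :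
    ((zonalLoSeries q s K : ℚ) : ℝ) ≤ zonal (-(Real.log (q : ℝ)) / 2) (s : ℝ) := by
  have hq0' : (0 : ℝ) < (q : ℝ) := by exact_mod_cast hq0
  have hq1' : ((q : ℚ) : ℝ) < 1 := by exact_mod_cast hq1
  have hρ' : 32 * ((q : ℚ) : ℝ) ^ ((K + 4) / 2) < 1 := by exact_mod_cast hρ
  have hs : |((s : ℚ) : ℝ)| ≤ 1 := abs_le.2 ⟨by exact_mod_cast hs1, by exact_mod_cast hs2⟩
  have h := partialSum_sub_geometric_le_zonal hq0' hq1' K hs hρ'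
  rw [zonalLoSeries, Rat.cast_sub, zonalPartialQ_cast, zonalTailQ_cast]
  exact h

/-- Monotonicity transport: a lower bound of `zonal (-(log q)/2) s` is a lower bound of
`zonal (-(log q)/2) t` for `-1 ≤ s ≤ t ≤ 1` (`monotoneOn_zonal`). [folklore] -/
theorem le_zonal_of_le_zonal {q : ℚ} (hq0 : 0 < q) (hq1 : q < 1) {x s t : ℝ} (hs1 : -1 ≤ s)
    (hst : s ≤ t) (ht1 : t ≤ 1) (hx : x ≤ zonal (-(Real.log (q : ℝ)) / 2) s) :
    x ≤ zonal (-(Real.log (q : ℝ)) / 2) t := by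
  have hq0' : (0 : ℝ) < (q : ℝ) := by exact_mod_cast hq0
  have hq1' : ((q : ℚ) : ℝ) < 1 := by exact_mod_cast hq1
  exact hx.trans (monotoneOn_zonal (neg_log_div_two_pos hq0' hq1')
    ⟨hs1, hst.trans ht1⟩ ⟨hs1.trans hst, ht1⟩ hst)

/-! ### A fast, dyadically rounded variant of the series lower bound

The exact partial sums carry the powers `q^{k(k+3)/2}` (thousands of digits at `K = 60`); the variant
below keeps only `p` fractional bits of the weights (rounded down AND up, the sign of `C_k(s)` decides
which one gives a lower bound of the term) and of the accumulator, with `C_k(s)` still exact. -/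

/-- Round `x` down to `p` fractional bits: `⌊x 2^p⌋/2^p`. [folklore] -/
def dyadicDn (x : ℚ) (p : ℕ) : ℚ := ((⌊x * 2 ^ p⌋ : ℤ) : ℚ) / 2 ^ p

/-- Round `x` up to `p` fractional bits: `-⌊-x 2^p⌋/2^p`. [folklore] -/
def dyadicUp (x : ℚ) (p : ℕ) : ℚ := -dyadicDn (-x) p

/-- `dyadicDn x p ≤ x`. [folklore] -/
theorem dyadicDn_le (x : ℚ) (p : ℕ) : dyadicDn x p ≤ x := by
  rw [dyadicDn, div_le_iff₀ (by positivity)]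
  exact Int.floor_le _

/-- `x ≤ dyadicUp x p`. [folklore] -/
theorem le_dyadicUp (x : ℚ) (p : ℕ) : x ≤ dyadicUp x p := by
  rw [dyadicUp, le_neg]
  exact dyadicDn_le _ _

/-- The state of the rounded one-pass summation after `k` steps: `(C_k(s), C_{k+1}(s), w⁻_k, w⁺_k, A_k)`
with `w⁻_k ≤ q^{k(k+3)/2} ≤ w⁺_k` and `A_k ≤ Σ_{j<k} q^{j(j+3)/2} (2j+3)/3 · C_j(s)`, all but the
(exact, small) `C_k` rounded to `p` fractional bits. [folklore] -/
def zonalStateR (q s : ℚ) (p : ℕ) : ℕ → ℚ × ℚ × ℚ × ℚ × ℚ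
  | 0 => (1, 3 * s, 1, 1, 0)
  | k + 1 =>
    let r := zonalStateR q s p k
    let qk : ℚ := q ^ (k + 2)
    let t : ℚ := (2 * (k : ℚ) + 3) / 3 * r.1
    (r.2.1, ((2 * (k : ℚ) + 5) * s * r.2.1 - ((k : ℚ) + 3) * r.1) / ((k : ℚ) + 2),
      dyadicDn (r.2.2.1 * qk) p, dyadicUp (r.2.2.2.1 * qk) p,
      dyadicDn (r.2.2.2.2 + if 0 ≤ t then r.2.2.1 * t else r.2.2.2.1 * t) p)

/-- Rounded lower bound of the partial sum `Σ_{k ≤ K} q^{k(k+3)/2} (2k+3)/3 · C_k(s)` with `p`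
fractional bits (fast: no number in the computation exceeds a few hundred bits). [folklore] -/
def zonalPartialLoR (q s : ℚ) (K p : ℕ) : ℚ := (zonalStateR q s p (K + 1)).2.2.2.2

/-- The fast certified series lower bound `zonalPartialLoR - zonalTailQ` of `zonal (-(log q)/2) s`
(`p` fractional bits; `zonalLoSeriesR ≤ zonalLoSeries`). [folklore] -/
def zonalLoSeriesR (q s : ℚ) (K p : ℕ) : ℚ := zonalPartialLoR q s K p - zonalTailQ q K

/-- The Gegenbauer components of the rounded state are exact. [folklore] -/
theorem zonalStateR_gegen (q s : ℚ) (p k : ℕ) :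
    (zonalStateR q s p k).1 = gegenQ k s ∧ (zonalStateR q s p k).2.1 = gegenQ (k + 1) s := by
  induction k with
  | zero => exact ⟨rfl, rfl⟩
  | succ k ih =>
    rw [zonalStateR]
    dsimp only
    rw [ih.1, ih.2, gegenQ_succ_succ]
    exact ⟨rfl, rfl⟩

/-- The invariant of the rounded summation (for `q ≥ 0`): two-sided weight enclosure and the
accumulator minorises the exact partial sum. [folklore] -/
theorem zonalStateR_le (q s : ℚ) (p : ℕ) (hq : 0 ≤ q) (k : ℕ) :
    (zonalStateR q s p k).2.2.1 ≤ q ^ (k * (k + 3) / 2) ∧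
      q ^ (k * (k + 3) / 2) ≤ (zonalStateR q s p k).2.2.2.1 ∧
      (zonalStateR q s p k).2.2.2.2 ≤
        ∑ j ∈ Finset.range k, q ^ (j * (j + 3) / 2) * ((2 * (j : ℚ) + 3) / 3) * gegenQ j s := by
  induction k with
  | zero => simp [zonalStateR]
  | succ k ih =>
    obtain ⟨hlo, hhi, hacc⟩ := ih
    have hc := (zonalStateR_gegen q s p k).1
    rw [zonalStateR]
    dsimp only
    refine ⟨(dyadicDn_le _ _).trans ?_, le_trans ?_ (le_dyadicUp _ _), (dyadicDn_le _ _).trans ?_⟩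
    · rw [← half_mul_add_three_succ, pow_add q (k * (k + 3) / 2) (k + 2)]
      exact mul_le_mul_of_nonneg_right hlo (pow_nonneg hq _)
    · rw [← half_mul_add_three_succ, pow_add q (k * (k + 3) / 2) (k + 2)]
      exact mul_le_mul_of_nonneg_right hhi (pow_nonneg hq _)
    · rw [Finset.sum_range_succ, hc]
      refine add_le_add hacc ?_
      rw [mul_assoc]
      split_ifs with ht
      · exact mul_le_mul_of_nonneg_right hlo ht
      · exact mul_le_mul_of_nonpos_right hhi (not_le.1 ht).le

/-- `zonalLoSeriesR ≤ zonalLoSeries` for `q ≥ 0`. [folklore] -/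
theorem zonalLoSeriesR_le_zonalLoSeries (q s : ℚ) (K p : ℕ) (hq : 0 ≤ q) :
    zonalLoSeriesR q s K p ≤ zonalLoSeries q s K := by
  rw [zonalLoSeriesR, zonalLoSeries, zonalPartialLoR, zonalPartialQ, zonalState_eq]
  exact sub_le_sub_right (zonalStateR_le q s p hq (K + 1)).2.2 _

/-- **Soundness of the fast series lower bound**: for `0 < q < 1`, `|s| ≤ 1`, `32 q^{⌊(K+4)/2⌋} < 1`
and any precision `p`, `zonalLoSeriesR q s K p ≤ zonal (-(log q)/2) s`. [folklore] -/
theorem zonalLoSeriesR_le_zonal {q s : ℚ} (K p : ℕ) (hq0 : 0 < q) (hq1 : q < 1)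
    (hρ : 32 * q ^ ((K + 4) / 2) < 1) (hs1 : -1 ≤ s) (hs2 : s ≤ 1) :
    ((zonalLoSeriesR q s K p : ℚ) : ℝ) ≤ zonal (-(Real.log (q : ℝ)) / 2) (s : ℝ) :=
  (Rat.cast_le.2 (zonalLoSeriesR_le_zonalLoSeries q s K p hq0.le)).trans
    (zonalLoSeries_le_zonal K hq0 hq1 hρ hs1 hs2)

/-- The fast series lower bound at `s` minorises `zonal (-(log q)/2)` on `[s, 1]`. [folklore] -/
theorem zonalLoSeriesR_le_zonal_of_le {q s : ℚ} (K p : ℕ) (hq0 : 0 < q) (hq1 : q < 1)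
    (hρ : 32 * q ^ ((K + 4) / 2) < 1) (hs1 : -1 ≤ s) (hs2 : s ≤ 1) {t : ℝ}
    (hst : ((s : ℚ) : ℝ) ≤ t) (ht1 : t ≤ 1) :
    ((zonalLoSeriesR q s K p : ℚ) : ℝ) ≤ zonal (-(Real.log (q : ℝ)) / 2) t :=
  le_zonal_of_le_zonal hq0 hq1 (by exact_mod_cast hs1) hst ht1
    (zonalLoSeriesR_le_zonal K p hq0 hq1 hρ hs1 hs2)

/-! ### The pole minorant -/

/-- The state of the one-pass summation at the pole after `k` steps:
`(q^{k(k+3)/2}, Σ_{j<k} q^{j(j+3)/2} (2j+3)/3 · (j+1)(j+2)/2)`. [folklore] -/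
def poleState (q : ℚ) : ℕ → ℚ × ℚ
  | 0 => (1, 0)
  | k + 1 =>
    let p := poleState q k
    (p.1 * q ^ (k + 2), p.2 + p.1 * ((2 * (k : ℚ) + 3) / 3) * (((k : ℚ) + 1) * ((k : ℚ) + 2) / 2))

/-- The pole minorant `Σ_{k ≤ K} q^{k(k+3)/2} (2k+3)/3 · (k+1)(k+2)/2` (the partial sum of the zonal
series at `s = 1`, where `C_k(1) = (k+1)(k+2)/2`), computed in one pass. [folklore] -/
def zonalPoleLo (q : ℚ) (K : ℕ) : ℚ := (poleState q (K + 1)).2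

/-- The invariant of the one-pass summation at the pole. [folklore] -/
theorem poleState_eq (q : ℚ) (k : ℕ) :
    poleState q k =
      (q ^ (k * (k + 3) / 2), ∑ j ∈ Finset.range k,
        q ^ (j * (j + 3) / 2) * ((2 * (j : ℚ) + 3) / 3) * (((j : ℚ) + 1) * ((j : ℚ) + 2) / 2)) := by
  induction k with
  | zero => simp [poleState]
  | succ k ih =>
    rw [poleState, ih]
    dsimp only
    rw [Finset.sum_range_succ, ← pow_add, half_mul_add_three_succ]

/-- The pole minorant as a `Finset` sum. [folklore] -/
theorem zonalPoleLo_eq (q : ℚ) (K : ℕ) :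
    zonalPoleLo q K = ∑ k ∈ Finset.range (K + 1),
      q ^ (k * (k + 3) / 2) * ((2 * (k : ℚ) + 3) / 3) * (((k : ℚ) + 1) * ((k : ℚ) + 2) / 2) := by
  rw [zonalPoleLo, poleState_eq]

/-- The pole minorant is nonnegative for `q ≥ 0`. [folklore] -/
theorem zonalPoleLo_nonneg (q : ℚ) (K : ℕ) (hq0 : 0 ≤ q) : 0 ≤ zonalPoleLo q K := by
  rw [zonalPoleLo_eq]
  exact Finset.sum_nonneg fun k _ => by positivity

/-- **Soundness of the pole minorant**: for `0 < q < 1`, `zonalPoleLo q K ≤ zonal (-(log q)/2) 1`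
(a partial sum of a series of nonnegative terms). [folklore] -/
theorem zonalPoleLo_le (q : ℚ) (K : ℕ) (hq0 : 0 < q) (hq1 : q < 1) :
    ((zonalPoleLo q K : ℚ) : ℝ) ≤ zonal (-(Real.log (q : ℝ)) / 2) 1 := by
  have hq0' : (0 : ℝ) < (q : ℝ) := by exact_mod_cast hq0
  have hq1' : ((q : ℚ) : ℝ) < 1 := by exact_mod_cast hq1
  have hτ := neg_log_div_two_pos hq0' hq1'
  have hsum := hasSum_zonal hτ (show |(1 : ℝ)| ≤ 1 by simp)
  have hle := sum_le_hasSum (Finset.range (K + 1))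
    (fun k _ => by rw [gegen_one]; exact mul_nonneg (wt_pos k _).le (by positivity)) hsum
  refine le_of_eq_of_le ?_ hle
  rw [zonalPoleLo_eq]
  push_cast
  refine Finset.sum_congr rfl fun k _ => ?_
  rw [wt_neg_log_div_two hq0', gegen_one]

end Cert

/-- **Registered helper `helper_certZonalLoSeries`** (crux item stmt-SmoothPoincare4-7632, line
`conformal-kernel-domination`): for `0 < q < 1`, `32 q^{⌊(K+4)/2⌋} < 1` and `-1 ≤ s ≤ 1`, the
computable rational `Cert.zonalLoSeries q s K` is a lower bound of the typed zonal heat kernel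
`zonal (-(log q)/2) t` for every `t ∈ [s, 1]` (series lower bound at `s` and monotonicity of
`zonal τ` on `[-1, 1]`). [folklore] -/
theorem helper_certZonalLoSeries : ∀ (q s : ℚ) (K : ℕ), 0 < q → q < 1 →
    32 * q ^ ((K + 4) / 2) < 1 → -1 ≤ s → s ≤ 1 → ∀ t : ℝ, ((s : ℚ) : ℝ) ≤ t → t ≤ 1 →
      ((Cert.zonalLoSeries q s K : ℚ) : ℝ) ≤ zonal (-(Real.log (q : ℝ)) / 2) t := by
  intro q s K hq0 hq1 hρ hs1 hs2 t hst ht1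
  exact Cert.le_zonal_of_le_zonal hq0 hq1 (by exact_mod_cast hs1) hst ht1
    (Cert.zonalLoSeries_le_zonal K hq0 hq1 hρ hs1 hs2)

end Summit.SmoothPoincare4.SmoothPoincare4.Theorems.CylinderEntropySliceIsolation
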